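import Mathlib.Analysis.Distribution.AEEqOfIntegralContDiff
import Mathlib.Analysis.Calculus.BumpFunction.FiniteDimension
import Mathlib.Analysis.Calculus.FDeriv.Symmetric
import Mathlib.Analysis.Calculus.Gradient.Basic
import Mathlib.Analysis.InnerProductSpace.Calculus
import Literature.Analysis.FluidPDE.ClassicalSolutionCalculus
import Literature.Analysis.FluidPDE.PressurePoisson
import Literature.Analysis.FunctionSpaces.SmoothParametricIntegral
import HarnessLib

/-!
# Reconstruction of the pressure: projected smooth solutions are classical solutions

Analysis/FluidPDE support file (first brick under the smoothing fact
`Literature.Analysis.FluidPDE.knss_classical_of_bounded_isBesovMildSolutionOn`,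
`NSCriticalClosureBesovBounded.lean`; Koch–Nadirashvili–Seregin–Šverák 2009, §4). The last step
of every "mild/very weak ⇒ classical" argument is pressure-free: once the velocity `u` is known
to be jointly smooth on `S × E` (`S` an open time set) and to satisfy the momentum equation
*against divergence-free test fields* — for every `t ∈ S` and every smooth compactly supported
divergence-free `φ`,
`∫ ⟪∂ₜu + (u·∇)u − νΔu − f, φ⟫ = 0` —
there is a jointly smooth pressure `p` with `∂ₜu + (u·∇)u = νΔu − ∇p + f` pointwise, i.e.
`(u, p)` is a classical solution in the sense of `Literature.Fluid.IsClassicalNSSolutionOn`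
(`exists_isClassicalNSSolutionOn_of_forall_integral_inner_eq_zero`). This file proves it, in
any finite-dimensional real inner product space `E`, in three elementary steps:

* **de Rham for smooth fields** (`inner_fderiv_comm_of_forall_integral_inner_eq_zero`): a smooth
  field `g` orthogonal to all divergence-free test fields has a symmetric derivative,
  `⟪Dg(x)v, w⟫ = ⟪Dg(x)w, v⟫` — test against `φ = (∂ᵥψ) w − (∂_w ψ) v`, which is divergence free
  by the symmetry of second derivatives, integrate by parts, and apply the fundamental lemma of
  the calculus of variations (Mathlib `ae_eq_zero_of_integral_contDiff_smul_eq_zero`);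
* **Poincaré's lemma with the segment potential** (`hasGradientAt_segmentIntegral`): for such `g`
  the function `q(x) = ∫₀¹ ⟪g(σx), x⟫ dσ` has `∇q = g` (differentiate under the integral,
  `Literature.Analysis.FunctionSpaces.hasFDerivAt_parametric_intervalIntegral`, use the symmetry, and
  integrate `d/dσ (σ ⟪g(σx), v⟫)`);
* **joint smoothness** of `(t, x) ↦ ∫₀¹ ⟪G(t, σx), x⟫ dσ` on `S × E` for an open `S`
  (`IsSmoothSpaceTimeOn.segmentIntegral`): localise in time with a bump function supported in
  `S` and apply `Literature.Analysis.FunctionSpaces.contDiff_parametric_intervalIntegral`.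

Sources: the argument is folklore (e.g. Galdi, *An Introduction to the Mathematical Theory of
the Navier–Stokes Equations*, Lemma III.1.1 — a distribution orthogonal to solenoidal test
fields is a gradient; Temam, *Navier–Stokes Equations*, Ch. I, Prop. 1.1); for smooth fields
on the whole space it reduces to the two classical lemmas above. No named facts are introduced.

## Mathlib

Used: `ContDiffAt.isSymmSndFDerivAt` (symmetry of second derivatives), `HasDerivAt.inner`,
`fderiv_inner_apply`, `ae_eq_zero_of_integral_contDiff_smul_eq_zero`, `ContDiffBump`,
`HasGradientAt`, `intervalIntegral.integral_eq_sub_of_hasDerivAt`. Mathlib's own Poincaré lemma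
(`Convex.exists_forall_hasFDerivAt_of_fderiv_symmetric`, for `E →L[ℝ] F`-valued 1-forms) gives
an abstract primitive; the explicit segment formula is used here because joint smoothness in
`(t, x)` is read off from it.
-/

noncomputable section

open MeasureTheory TopologicalSpace Set Function Filter Metric intervalIntegral
open _root_.Topology
open scoped ContDiff RealInnerProductSpace Laplacian

namespace Literature.Analysis.FluidPDE

variable {E : Type*} [NormedAddCommGroup E] [InnerProductSpace ℝ E] [FiniteDimensional ℝ E]

/-! ### de Rham for smooth fields: orthogonality to divergence-free tests -/

section DeRham

variable [MeasurableSpace E] [BorelSpace E]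

omit [MeasurableSpace E] [BorelSpace E] in
/-- `div ((∂ₑψ) w) (x) = D²ψ(x)(w)(e)` for a smooth scalar `ψ` and constant vectors `e`, `w`:
the divergence of the rank-one field `x ↦ (Dψ(x) e) w` is `D(Dψ · e)(x) w`. [folklore] -/
theorem divergence_fderiv_apply_smul {ψ : E → ℝ} (hψ : ContDiff ℝ ∞ ψ) (e w x : E) :
    VectorCalculus.divergence (fun y => (fderiv ℝ ψ y e) • w) x =
      fderiv ℝ (fderiv ℝ ψ) x w e := by
  have hd1 : Differentiable ℝ (fderiv ℝ ψ) :=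
    (hψ.fderiv_right (m := 1) (by norm_cast)).differentiable (by norm_num)
  have hc : DifferentiableAt ℝ (fun y => fderiv ℝ ψ y e) x :=
    (hd1 x).clm_apply (differentiableAt_const e)
  simp only [VectorCalculus.divergence]
  rw [fderiv_smul_const hc w]
  rw [show ((fderiv ℝ (fun y => fderiv ℝ ψ y e) x).smulRight w : E →ₗ[ℝ] E) =
      (fderiv ℝ (fun y => fderiv ℝ ψ y e) x : E →ₗ[ℝ] ℝ).smulRight w from rfl,
    LinearMap.trace_smulRight]
  show fderiv ℝ (fun y => fderiv ℝ ψ y e) x w = fderiv ℝ (fderiv ℝ ψ) x w e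
  rw [fderiv_clm_apply (hd1 x) (differentiableAt_const e)]
  simp

omit [MeasurableSpace E] [BorelSpace E] in
/-- The test field `φ = (∂ᵥψ) w − (∂_w ψ) v` is divergence free (symmetry of `D²ψ`). [folklore] -/
theorem isDivFree_fderiv_smul_sub {ψ : E → ℝ} (hψ : ContDiff ℝ ∞ ψ) (v w : E) :
    VectorCalculus.IsDivFree (fun y => (fderiv ℝ ψ y v) • w - (fderiv ℝ ψ y w) • v) := by
  intro x
  have hd1 : Differentiable ℝ (fderiv ℝ ψ) :=
    (hψ.fderiv_right (m := 1) (by norm_cast)).differentiable (by norm_num)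
  have hc : ∀ e z : E, DifferentiableAt ℝ (fun y => (fderiv ℝ ψ y e) • z) x := fun e z =>
    ((hd1 x).clm_apply (differentiableAt_const e)).smul_const z
  rw [divergence_sub_apply (hc v w) (hc w v), divergence_fderiv_apply_smul hψ,
    divergence_fderiv_apply_smul hψ]
  have hs : IsSymmSndFDerivAt ℝ ψ x :=
    hψ.contDiffAt.isSymmSndFDerivAt
      (by rw [minSmoothness_of_isRCLikeNormedField]; norm_cast)
  rw [hs w v, sub_self]

omit [FiniteDimensional ℝ E] [MeasurableSpace E] [BorelSpace E] in
/-- The test field `φ = (∂ᵥψ) w − (∂_w ψ) v` built from a test function `ψ` is a test field. [folklore] -/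
theorem isTestFunctionOn_fderiv_smul_sub {ψ : E → ℝ} (hψ : ContDiff ℝ ∞ ψ)
    (hsupp : HasCompactSupport ψ) (v w : E) :
    FunctionSpaces.IsTestFunctionOn (⊤ : Opens E)
      (fun y => (fderiv ℝ ψ y v) • w - (fderiv ℝ ψ y w) • v) where
  contDiff :=
    (((hψ.fderiv_right (m := ∞) le_rfl).clm_apply contDiff_const).smul contDiff_const).sub
      (((hψ.fderiv_right (m := ∞) le_rfl).clm_apply contDiff_const).smul contDiff_const)
  hasCompactSupport :=
    ((hsupp.fderiv_apply (𝕜 := ℝ) v).smul_right (f' := fun _ => w)).sub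
      ((hsupp.fderiv_apply (𝕜 := ℝ) w).smul_right (f' := fun _ => v))
  tsupport_subset := fun _ _ => trivial

/-- **Integration by parts against a test function, one derivative**: for `ψ ∈ C^∞_c` and a `C¹`
function `k`, `∫ (∂ₑψ) k = −∫ ψ (∂ₑk)` (no boundary terms on the whole space,
`integral_fderiv_apply_eq_zero` applied to `ψ k`). [folklore] -/
theorem integral_fderiv_apply_mul_eq_neg {ψ k : E → ℝ} (hψ : ContDiff ℝ ∞ ψ)
    (hsupp : HasCompactSupport ψ) (hk : ContDiff ℝ 1 k) (e : E) :
    ∫ x, fderiv ℝ ψ x e * k x = -∫ x, ψ x * fderiv ℝ k x e := by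
  have hψ1 : ContDiff ℝ 1 ψ := hψ.of_le (by exact_mod_cast le_top)
  have h0 := integral_fderiv_apply_eq_zero (h := fun x => ψ x * k x) (hψ1.mul hk)
    (hsupp.mul_right) e
  have hprod : ∀ x, fderiv ℝ (fun x => ψ x * k x) x e =
      fderiv ℝ ψ x e * k x + ψ x * fderiv ℝ k x e := fun x => by
    rw [fderiv_fun_mul ((hψ1.differentiable one_ne_zero) x) ((hk.differentiable one_ne_zero) x)]
    simp only [_root_.add_apply, _root_.FunLike.coe_smul, Pi.smul_apply, smul_eq_mul]
    ring
  simp_rw [hprod] at h0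
  have hi₁ : Integrable (fun x => fderiv ℝ ψ x e * k x) := by
    refine Continuous.integrable_of_hasCompactSupport ?_ ((hsupp.fderiv_apply (𝕜 := ℝ) e).mul_right)
    exact ((hψ.continuous_fderiv (by simp)).clm_apply continuous_const).mul hk.continuous
  have hi₂ : Integrable (fun x => ψ x * fderiv ℝ k x e) := by
    refine Continuous.integrable_of_hasCompactSupport ?_ (hsupp.mul_right)
    exact hψ.continuous.mul ((hk.continuous_fderiv one_ne_zero).clm_apply continuous_const)
  rw [integral_add hi₁ hi₂] at h0
  linarith

/-- **de Rham's theorem for smooth fields on the whole space** (the symmetric-derivative form):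
if a smooth vector field `g` satisfies `∫ ⟪g, φ⟫ = 0` for every smooth compactly supported
divergence-free field `φ`, then its derivative is symmetric, `⟪Dg(x) v, w⟫ = ⟪Dg(x) w, v⟫`
(i.e. `curl g = 0`; whence `g` is a gradient, `hasGradientAt_segmentIntegral`). Proof: test
against `φ = (∂ᵥψ) w − (∂_w ψ) v` and integrate by parts to get
`∫ ψ (∂ᵥ⟪g, w⟫ − ∂_w⟪g, v⟫) = 0` for all test `ψ`, then apply the fundamental lemma of the
calculus of variations (Galdi, Lemma III.1.1; Temam, Ch. I Prop. 1.1). [folklore] -/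
theorem inner_fderiv_comm_of_forall_integral_inner_eq_zero {g : E → E} (hg : ContDiff ℝ ∞ g)
    (horth : ∀ φ : E → E, FunctionSpaces.IsTestFunctionOn (⊤ : Opens E) φ →
      VectorCalculus.IsDivFree φ → ∫ x, ⟪g x, φ x⟫ = 0) (x v w : E) :
    ⟪fderiv ℝ g x v, w⟫ = ⟪fderiv ℝ g x w, v⟫ := by
  -- the scalar components `k_z = ⟪g, z⟫` and their directional derivatives
  have hk : ∀ z : E, ContDiff ℝ ∞ (fun y => ⟪g y, z⟫) := fun z => hg.inner ℝ contDiff_const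
  have hk1 : ∀ z : E, ContDiff ℝ 1 (fun y => ⟪g y, z⟫) := fun z =>
    (hk z).of_le (by exact_mod_cast le_top)
  have hdk : ∀ z e y : E, fderiv ℝ (fun y => ⟪g y, z⟫) y e = ⟪fderiv ℝ g y e, z⟫ := by
    intro z e y
    rw [fderiv_inner_apply ℝ ((hg.differentiable (by simp)) y) (differentiableAt_const z)]
    simp
  -- the continuous function that must vanish
  set m : E → ℝ := fun y => ⟪fderiv ℝ g y v, w⟫ - ⟪fderiv ℝ g y w, v⟫ with hm
  have hmc : Continuous m := by
    have hc : ∀ e z : E, Continuous fun y => ⟪fderiv ℝ g y e, z⟫ := fun e z =>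
      ((hg.continuous_fderiv (by simp)).clm_apply continuous_const).inner continuous_const
    exact (hc v w).sub (hc w v)
  -- `∫ ψ m = 0` for every test function `ψ`
  have hzero : ∀ ψ : E → ℝ, ContDiff ℝ ∞ ψ → HasCompactSupport ψ → ∫ y, ψ y • m y = 0 := by
    intro ψ hψ hsupp
    have h1 := horth _ (isTestFunctionOn_fderiv_smul_sub hψ hsupp v w)
      (isDivFree_fderiv_smul_sub hψ v w)
    have hexp : ∀ y, ⟪g y, (fderiv ℝ ψ y v) • w - (fderiv ℝ ψ y w) • v⟫ =
        fderiv ℝ ψ y v * ⟪g y, w⟫ - fderiv ℝ ψ y w * ⟪g y, v⟫ := fun y => by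
      rw [inner_sub_right, real_inner_smul_right, real_inner_smul_right]
    simp_rw [hexp] at h1
    have hi : ∀ e z : E, Integrable (fun y => fderiv ℝ ψ y e * ⟪g y, z⟫) := fun e z =>
      (((hψ.continuous_fderiv (by simp)).clm_apply continuous_const).mul (hk z).continuous)
        |>.integrable_of_hasCompactSupport ((hsupp.fderiv_apply (𝕜 := ℝ) e).mul_right)
    rw [integral_sub (hi v w) (hi w v), integral_fderiv_apply_mul_eq_neg hψ hsupp (hk1 w) v,
      integral_fderiv_apply_mul_eq_neg hψ hsupp (hk1 v) w] at h1
    have hi' : ∀ e z : E, Integrable (fun y => ψ y * fderiv ℝ (fun y => ⟪g y, z⟫) y e) :=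
      fun e z => (hψ.continuous.mul (((hk z).continuous_fderiv (by simp)).clm_apply
        continuous_const)).integrable_of_hasCompactSupport hsupp.mul_right
    have h2 : ∫ y, ψ y • m y = ∫ y, (ψ y * fderiv ℝ (fun y => ⟪g y, w⟫) y v -
        ψ y * fderiv ℝ (fun y => ⟪g y, v⟫) y w) := by
      refine integral_congr_ae (Eventually.of_forall fun y => ?_)
      simp only [hm, hdk, smul_eq_mul]
      ring
    rw [h2, integral_sub (hi' v w) (hi' w v)]
    linarith
  -- fundamental lemma: `m = 0` a.e., hence everywhere by continuity
  have hae : ∀ᵐ y ∂(volume : Measure E), m y = 0 :=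
    ae_eq_zero_of_integral_contDiff_smul_eq_zero hmc.locallyIntegrable hzero
  have hall : m = fun _ => 0 :=
    (hmc.ae_eq_iff_eq volume continuous_const).1 hae
  have := congr_fun hall x
  simp only [hm] at this
  linarith

end DeRham

/-! ### Poincaré's lemma with the segment potential -/

section Poincare

omit [FiniteDimensional ℝ E] in
/-- Derivative along a ray: `d/dτ ⟪g(τ x), v⟫ = ⟪Dg(τ x) x, v⟫`. [folklore] -/
theorem hasDerivAt_inner_comp_smul {g : E → E} (hg : ContDiff ℝ ∞ g) (x v : E) (σ : ℝ) :
    HasDerivAt (fun τ : ℝ => ⟪g (τ • x), v⟫) ⟪fderiv ℝ g (σ • x) x, v⟫ σ := by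
  have h1 : HasDerivAt (fun τ : ℝ => τ • x) x σ := by
    simpa using (hasDerivAt_id σ).smul_const x
  have h2 : HasDerivAt (fun τ : ℝ => g (τ • x)) (fderiv ℝ g (σ • x) x) σ :=
    ((hg.differentiable (by simp)) (σ • x)).hasFDerivAt.comp_hasDerivAt σ h1
  simpa using h2.inner ℝ (hasDerivAt_const σ v)

omit [FiniteDimensional ℝ E] in
/-- The partial derivative in `y` of the segment integrand `H(σ, y) = ⟪g(σ y), y⟫`:
`∂_y H(σ, x) v = ⟪g(σ x), v⟫ + ⟪Dg(σ x)(σ v), x⟫`. [folklore] -/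
theorem fderiv_inner_comp_smul_apply {g : E → E} (hg : ContDiff ℝ ∞ g) (σ : ℝ) (x v : E) :
    fderiv ℝ (fun y : E => ⟪g (σ • y), y⟫) x v = ⟪g (σ • x), v⟫ + ⟪fderiv ℝ g (σ • x) (σ • v), x⟫ := by
  have hgd : Differentiable ℝ g := hg.differentiable (by simp)
  have h1 : HasFDerivAt (fun y : E => g (σ • y))
      ((fderiv ℝ g (σ • x)).comp (σ • ContinuousLinearMap.id ℝ E)) x :=
    (hgd (σ • x)).hasFDerivAt.comp x ((hasFDerivAt_id x).const_smul σ)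
  have h2 : HasFDerivAt (fun y : E => ⟪g (σ • y), y⟫)
      ((fderivInnerCLM ℝ (g (σ • x), x)).comp
        (((fderiv ℝ g (σ • x)).comp (σ • ContinuousLinearMap.id ℝ E)).prod
          (ContinuousLinearMap.id ℝ E))) x :=
    h1.inner ℝ (hasFDerivAt_id x)
  rw [h2.fderiv]
  simp [fderivInnerCLM_apply, real_inner_comm]

/-- **Poincaré's lemma on the whole space, with the segment potential.** If `g` is a smooth
vector field with symmetric derivative, `⟪Dg(x) v, w⟫ = ⟪Dg(x) w, v⟫`, then
`q(y) = ∫₀¹ ⟪g(σ y), y⟫ dσ` satisfies `∇q = g`: differentiating under the integral sign,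
`∂ᵥ q(x) = ∫₀¹ (⟪g(σx), v⟫ + σ ⟪Dg(σx) v, x⟫) dσ = ∫₀¹ d/dσ (σ ⟪g(σx), v⟫) dσ = ⟪g(x), v⟫`
by the symmetry. [folklore] -/
theorem hasGradientAt_segmentIntegral {g : E → E} (hg : ContDiff ℝ ∞ g)
    (hsymm : ∀ x v w : E, ⟪fderiv ℝ g x v, w⟫ = ⟪fderiv ℝ g x w, v⟫) (x : E) :
    HasGradientAt (fun y => ∫ σ in (0 : ℝ)..1, ⟪g (σ • y), y⟫) (g x) x := by
  -- the smooth integrand on `ℝ × E`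
  set H : ℝ × E → ℝ := fun q => ⟪g (q.1 • q.2), q.2⟫ with hH
  have hHs : ContDiff ℝ ∞ H := (hg.comp (contDiff_fst.smul contDiff_snd)).inner ℝ contDiff_snd
  have hn : (∞ : WithTop ℕ∞) ≠ 0 := by simp
  have hD := FunctionSpaces.hasFDerivAt_parametric_intervalIntegral hHs hn 0 1 x
  -- the directional derivatives of the integrand
  have hdir : ∀ (σ : ℝ) (v : E),
      ((fderiv ℝ H (σ, x)).comp (ContinuousLinearMap.inr ℝ ℝ E)) v =
        ⟪g (σ • x), v⟫ + σ * ⟪fderiv ℝ g (σ • x) x, v⟫ := by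
    intro σ v
    rw [← (FunctionSpaces.hasFDerivAt_comp_prodMk hHs hn σ x).fderiv]
    change fderiv ℝ (fun y : E => ⟪g (σ • y), y⟫) x v = _
    rw [fderiv_inner_comp_smul_apply hg, map_smul, real_inner_smul_left, hsymm]
  -- continuity of the derivative family in `σ`
  have hcont : Continuous fun σ : ℝ =>
      (fderiv ℝ H (σ, x)).comp (ContinuousLinearMap.inr ℝ ℝ E) :=
    ((ContinuousLinearMap.compL ℝ E (ℝ × E) ℝ).flip
      (ContinuousLinearMap.inr ℝ ℝ E)).continuous.comp
      ((hHs.continuous_fderiv hn).comp (continuous_id.prodMk continuous_const))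
  -- identification of the derivative with `⟪g x, ·⟫`
  have hderiv_eq : (∫ σ in (0 : ℝ)..1, (fderiv ℝ H (σ, x)).comp (ContinuousLinearMap.inr ℝ ℝ E)) =
      InnerProductSpace.toDual ℝ E (g x) := by
    ext v
    rw [ContinuousLinearMap.intervalIntegral_apply (hcont.intervalIntegrable 0 1),
      InnerProductSpace.toDual_apply_apply]
    simp_rw [hdir]
    have hF : ∀ σ : ℝ, HasDerivAt (fun σ : ℝ => σ * ⟪g (σ • x), v⟫)
        (⟪g (σ • x), v⟫ + σ * ⟪fderiv ℝ g (σ • x) x, v⟫) σ := fun σ => by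
      have h := (hasDerivAt_id σ).mul (hasDerivAt_inner_comp_smul hg x v σ)
      have h' : HasDerivAt (fun σ : ℝ => σ * ⟪g (σ • x), v⟫)
          (1 * ⟪g (σ • x), v⟫ + id σ * ⟪fderiv ℝ g (σ • x) x, v⟫) σ := h
      simpa using h'
    have hc' : Continuous fun σ : ℝ => ⟪g (σ • x), v⟫ + σ * ⟪fderiv ℝ g (σ • x) x, v⟫ := by
      have hgc : Continuous g := hg.continuous
      have hdc : Continuous (fderiv ℝ g) := hg.continuous_fderiv hn
      fun_prop
    rw [integral_eq_sub_of_hasDerivAt (fun σ _ => hF σ) (hc'.intervalIntegrable 0 1)]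
    simp
  have := hD
  rw [hderiv_eq] at this
  exact this

end Poincare

/-! ### Joint smoothness of the segment potential of a time-dependent field -/

section SpaceTime

variable {X : Type*} [NormedAddCommGroup X] [NormedSpace ℝ X]
variable {F : Type*} [NormedAddCommGroup F] [NormedSpace ℝ F]

omit [NormedAddCommGroup E] [InnerProductSpace ℝ E] [FiniteDimensional ℝ E] in
/-- **Time localisation.** A field jointly smooth on `S × X`, `S` open, multiplied by a smooth
function of time whose topological support lies in `S`, is (extended by its own values, which
are then irrelevant) jointly smooth on all of `ℝ × X`. [folklore] -/
theorem IsSmoothSpaceTimeOn.contDiff_smul_of_tsupport_subset {S : Set ℝ} (hS : IsOpen S)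
    {w : ℝ → X → F} (h : IsSmoothSpaceTimeOn S w) {χ : ℝ → ℝ} (hχ : ContDiff ℝ ∞ χ)
    (hsupp : tsupport χ ⊆ S) : ContDiff ℝ ∞ fun z : ℝ × X => χ z.1 • w z.1 z.2 := by
  refine contDiff_iff_contDiffAt.2 fun z => ?_
  obtain ⟨t, x⟩ := z
  by_cases ht : t ∈ S
  · have hw : ContDiffAt ℝ ∞ (uncurry w) (t, x) :=
      ContDiffOn.contDiffAt h ((hS.prod isOpen_univ).mem_nhds (mk_mem_prod ht (mem_univ x)))
    exact (hχ.comp contDiff_fst).contDiffAt.smul hw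
  · have ht' : t ∉ tsupport χ := fun h' => ht (hsupp h')
    have hzero : χ =ᶠ[𝓝 t] 0 := notMem_tsupport_iff_eventuallyEq.1 ht'
    have hzero' : (fun z : ℝ × X => χ z.1 • w z.1 z.2) =ᶠ[𝓝 (t, x)] fun _ => 0 := by
      have h1 : ∀ᶠ z : ℝ × X in 𝓝 (t, x), χ z.1 = 0 :=
        (continuous_fst.tendsto (t, x)).eventually hzero
      filter_upwards [h1] with z hz
      simp [hz]
    exact (contDiffAt_const (c := (0 : F))).congr_of_eventuallyEq hzero'

omit [FiniteDimensional ℝ E] in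
/-- A bump in time around `t₀ ∈ S` (`S` open) with topological support inside `S`. [folklore] -/
theorem exists_contDiffBump_tsupport_subset {S : Set ℝ} (hS : IsOpen S) {t₀ : ℝ} (ht₀ : t₀ ∈ S) :
    ∃ χ : ContDiffBump t₀, tsupport χ ⊆ S := by
  obtain ⟨ε, hε, hball⟩ := Metric.isOpen_iff.1 hS t₀ ht₀
  refine ⟨⟨ε / 4, ε / 2, by positivity, by linarith⟩, ?_⟩
  rw [ContDiffBump.tsupport_eq]
  exact (closedBall_subset_ball (by linarith)).trans hball

/-- **Joint smoothness of the segment potential.** If `G` is jointly smooth on `S × E` with `S`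
open, then so is `(t, x) ↦ ∫₀¹ ⟪G(t, σ x), x⟫ dσ`: near `t₀ ∈ S` it coincides with the parametric
integral of the globally smooth integrand `(σ, t, x) ↦ χ(t) ⟪G(t, σ x), x⟫`, `χ` a bump equal
to `1` near `t₀` and supported in `S`
(`Literature.Analysis.FunctionSpaces.contDiff_parametric_intervalIntegral`). [folklore] -/
theorem IsSmoothSpaceTimeOn.segmentIntegral {S : Set ℝ} (hS : IsOpen S) {G : ℝ → E → E}
    (hG : IsSmoothSpaceTimeOn S G) :
    IsSmoothSpaceTimeOn S (fun t x => ∫ σ in (0 : ℝ)..1, ⟪G t (σ • x), x⟫) := by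
  intro z hz
  obtain ⟨t₀, x₀⟩ := z
  have ht₀ : t₀ ∈ S := hz.1
  obtain ⟨χ, hχ⟩ := exists_contDiffBump_tsupport_subset hS ht₀
  -- the globally smooth localised integrand
  have hGχ : ContDiff ℝ ∞ fun z : ℝ × E => (χ : ℝ → ℝ) z.1 • G z.1 z.2 :=
    hG.contDiff_smul_of_tsupport_subset hS χ.contDiff hχ
  set H : ℝ × (ℝ × E) → ℝ :=
    fun r => ⟪(χ : ℝ → ℝ) r.2.1 • G r.2.1 (r.1 • r.2.2), r.2.2⟫ with hH
  have hHs : ContDiff ℝ ∞ H := by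
    have hA : ContDiff ℝ ∞ fun r : ℝ × (ℝ × E) => ((r.2.1, r.1 • r.2.2) : ℝ × E) :=
      (contDiff_fst.comp contDiff_snd).prodMk (contDiff_fst.smul (contDiff_snd.comp contDiff_snd))
    exact (hGχ.comp hA).inner ℝ (contDiff_snd.comp contDiff_snd)
  have hP : ContDiff ℝ ∞ fun q : ℝ × E => ∫ σ in (0 : ℝ)..1, H (σ, q) :=
    FunctionSpaces.contDiff_parametric_intervalIntegral hHs 0 1
  -- near `(t₀, x₀)` the localised integral is the segment potential
  have heq : (uncurry fun t x => ∫ σ in (0 : ℝ)..1, ⟪G t (σ • x), x⟫) =ᶠ[𝓝 (t₀, x₀)]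
      fun q : ℝ × E => ∫ σ in (0 : ℝ)..1, H (σ, q) := by
    have h1 : ∀ᶠ q : ℝ × E in 𝓝 (t₀, x₀), (χ : ℝ → ℝ) q.1 = 1 :=
      (continuous_fst.tendsto (t₀, x₀)).eventually χ.eventuallyEq_one
    filter_upwards [h1] with q hq
    obtain ⟨t, x⟩ := q
    have hq' : (χ : ℝ → ℝ) t = 1 := hq
    simp [hH, hq']
  exact ((hP.contDiffAt.congr_of_eventuallyEq heq).contDiffWithinAt)

end SpaceTime

/-! ### Projected smooth solutions are classical solutions -/

section Classical

variable [MeasurableSpace E] [BorelSpace E]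

/-- **Reconstruction of the pressure.** Let `S` be an open time set and let `u`, `f` be jointly
smooth on `S × E`, `u(t)` divergence free, such that the momentum equation holds against
divergence-free test fields: for every `t ∈ S` and every smooth compactly supported
divergence-free `φ`, `∫ ⟪∂ₜu + (u·∇)u − νΔu − f, φ⟫ = 0` (the projected, pressure-free form in
which mild / very weak solutions are found to satisfy the equations once they are known to be
smooth; Koch–Nadirashvili–Seregin–Šverák 2009, §4). Then there is a jointly smooth pressure `p`
— the segment potential `p(t, x) = ∫₀¹ ⟪G(t, σx), x⟫ dσ` of the smooth curl-free field
`G = −(∂ₜu + (u·∇)u − νΔu − f)` (de Rham: `inner_fderiv_comm_of_forall_integral_inner_eq_zero`;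
Poincaré: `hasGradientAt_segmentIntegral`) — such that `(u, p)` is a classical solution on `S`
(Galdi, Lemma III.1.1; Temam, Ch. I Prop. 1.1). [folklore] -/
theorem exists_isClassicalNSSolutionOn_of_forall_integral_inner_eq_zero {S : Set ℝ}
    (hS : IsOpen S) {ν : ℝ} {f u : ℝ → E → E} (hu : IsSmoothSpaceTimeOn S u)
    (hf : IsSmoothSpaceTimeOn S f) (hdiv : ∀ t ∈ S, VectorCalculus.IsDivFree (u t))
    (horth : ∀ t ∈ S, ∀ φ : E → E, FunctionSpaces.IsTestFunctionOn (⊤ : Opens E) φ →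
      VectorCalculus.IsDivFree φ →
        ∫ x, ⟪timeDerivWithin S u t x + convect (u t) (u t) x - ν • (Δ (u t)) x - f t x, φ x⟫ = 0) :
    ∃ p : ℝ → E → ℝ, IsClassicalNSSolutionOn S ν f u p := by
  have hSU : UniqueDiffOn ℝ S := hS.uniqueDiffOn
  -- the smooth curl-free field `G = -(∂ₜu + (u·∇)u − νΔu − f)`
  set G : ℝ → E → E := fun t x =>
    -(timeDerivWithin S u t x + convect (u t) (u t) x - ν • (Δ (u t)) x - f t x) with hGdef
  have hG : IsSmoothSpaceTimeOn S G := by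
    have h1 := (((hu.timeDerivWithin hSU).add (hu.convect hu hSU)).sub
      ((hu.laplacian hSU).const_smul ν)).sub hf
    exact ContDiffOn.neg h1
  have horthG : ∀ t ∈ S, ∀ φ : E → E, FunctionSpaces.IsTestFunctionOn (⊤ : Opens E) φ →
      VectorCalculus.IsDivFree φ → ∫ x, ⟪G t x, φ x⟫ = 0 := by
    intro t ht φ hφ hφd
    have h1 := horth t ht φ hφ hφd
    simp only [hGdef, inner_neg_left, MeasureTheory.integral_neg, h1, neg_zero]
  -- the pressure: the segment potential of `G`
  refine ⟨fun t x => ∫ σ in (0 : ℝ)..1, ⟪G t (σ • x), x⟫, ?_⟩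
  have hgrad : ∀ t ∈ S, ∀ x, gradient (fun y => ∫ σ in (0 : ℝ)..1, ⟪G t (σ • y), y⟫) x = G t x := by
    intro t ht x
    have hGt : ContDiff ℝ ∞ (G t) := hG.contDiff_slice ht
    exact (hasGradientAt_segmentIntegral hGt
      (inner_fderiv_comm_of_forall_integral_inner_eq_zero hGt (horthG t ht)) x).gradient
  exact
    { smooth_velocity := hu
      smooth_pressure := hG.segmentIntegral hS
      momentum := fun t ht x => by
        rw [hgrad t ht x, hGdef]
        simp only [neg_sub]
        abel
      divFree := hdiv }

end Classical

end Literature.Analysis.FluidPDE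

end
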